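import Summits.BirchSwinnertonDyer.BirchSwinnertonDyer.Theses.AlignedTransportAtTwo
import Literature.NumberTheory.EllipticCurves.KatoDivisibilityAllPrimes
import Literature.NumberTheory.EllipticCurves.Greenberg1999.RankZeroEulerCharacteristicAnyPrime
import Literature.NumberTheory.EllipticCurves.ModularCurvePeriodRatio
import Summits.BirchSwinnertonDyer.BirchSwinnertonDyer.Theorems.AlignedTransportAtTwoMainConjectureOfRankZeroBSDAtTwoSeed
import Summits.BirchSwinnertonDyer.BirchSwinnertonDyer.Theorems.AlignedTransportAtTwoMainConjectureOfRankZeroBSDAtTwoFineRoadCrux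
import Summits.BirchSwinnertonDyer.BirchSwinnertonDyer.Theorems.AlignedTransportAtTwoMainConjectureOfRankZeroBSDAtTwoFineRoadQiCrux
import Summits.BirchSwinnertonDyer.BirchSwinnertonDyer.Theorems.AlignedTransportAtTwoMainConjectureOfRankZeroBSDAtTwoFineRoadCoinvCruxArch
import Summits.BirchSwinnertonDyer.BirchSwinnertonDyer.Theorems.AlignedTransportAtTwoMainConjectureOfRankZeroBSDAtTwoKatoMuRoad
import Summits.BirchSwinnertonDyer.BirchSwinnertonDyer.Theorems.AlignedTransportAtTwoMainConjectureOfRankZeroBSDAtTwoFineRoadCoinvDataTight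
import Summits.BirchSwinnertonDyer.BirchSwinnertonDyer.Theorems.AlignedTransportAtTwoMainConjectureOfRankZeroBSDAtTwoTorsionPointFieldCrux
import Literature.NumberTheory.EllipticCurves.KatoFineSelmerDualRelaxedAtInfinity
import Summits.BirchSwinnertonDyer.BirchSwinnertonDyer.Theorems.AlignedTransportAtTwoMainConjectureOfRankZeroBSDAtTwoFineRoadArchNettingRel
import Summits.BirchSwinnertonDyer.BirchSwinnertonDyer.Theorems.AlignedTransportAtTwoMainConjectureOfRankZeroBSDAtTwoFineRoadRelaxedFine
import Summits.BirchSwinnertonDyer.BirchSwinnertonDyer.Theorems.AlignedTransportAtTwoMainConjectureOfRankZeroBSDAtTwoFineRoadLimRelUpstairs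
import Summits.BirchSwinnertonDyer.BirchSwinnertonDyer.Theorems.AlignedTransportAtTwoMainConjectureOfRankZeroBSDAtTwoMuNecessity
import Summits.BirchSwinnertonDyer.BirchSwinnertonDyer.Theorems.AlignedTransportAtTwoMainConjectureOfRankZeroBSDAtTwoSexticCriterion
import HarnessLib

/-! # Line `birth` (planner -imc g3), RESHAPED by the lead prover `bsd-line-att-p2` (gen 0, gen 2) — crux
`Summit.BirchSwinnertonDyer.BirchSwinnertonDyer.Theses.AlignedTransportAtTwo.MainConjectureOfRankZeroBSDAtTwo`
(stmt-BirchSwinnertonDyer-22298, the SEED of route `route-BirchSwinnertonDyer-AlignedTransportAtTwo`).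

Gen 0 (p583329): Kato's divisibility 17.4 (2) at `2` is PRINT, the «equality from the ends» chain at `2` is a
tree engine, and MODULO PRINT the crux is EQUIVALENT to stub T (`SeedMuZeroAtTwo` = Greenberg Conj. 1.11 at
`2` on the seed cell). Gen 2 (p593068 + `…FineRoadCrux`): ROAD (b) to T — Kato's §17.13 bookkeeping at
`𝔭 = (2)` WITHOUT the Euler-system bound + Coates–Sujatha (A) via Lim 2017 at `2` — on which the crux's analytic
`μ₂ = 0` binder is load-bearing; it splits T into a LOCAL statement at `2` (K₂) and a CLASS-GROUP statement
about the seeds' cubic fields (A₂). Stubs: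

* `stub_publishedInputsAtTwo : PublishedInputsAtTwo` — PRINT conjunction (Kato 17.4 (1)(2) at `2`; Greenberg
  1999 Thm. 4.1 parity-free; period unit at `2` = Abbes–Ullmo; modularity; GZK). Conditional for ever.
* `stub_seedMuZeroAtTwo : SeedMuZeroAtTwo` — ROAD (a): `μ(X(W/ℚ_∞)) = 0` at `2` on the seed cell = Greenberg
  Conj. 1.11 at `2` (OPEN). Modulo P the crux ⟺ T (`mainConjectureOfRankZeroBSDAtTwo_iff_seedMuZero`).
* `stub_limAtTwo : LimAtTwo` — PRINT (Lim 2017 Thm. 3.5 + Lemma 3.2 at `p = 2`, tree fact). Conditional.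
* `KatoFineDataAtTwo` (displayed) — ROAD (b), (K₂): Kato's §17.13 data at GOOD ORDINARY `2` in
  fine form (Poitou–Tate row `𝐇¹ → P → X → X₀`, injective Coleman map, zeta class hitting `s·G`, `s ∉ (2)`,
  for the integral lift `G` of `L₂(f, α)`) — a construction TARGET, NOT in print at `𝔭 = (2)` (Kato prints
  17.11 / 16.6 / (17.13.1) / Conj. 12.10 at `p = 2` only away from `(2)`); the place where a `2`-power defect
  (Δ-descent from `ℚ(ζ_{2^∞})`, archimedean strict/relaxed, anomalous factor) would show.
* `stub_classicalMuSeedFieldsAtTwo : ClassicalMuSeedFieldsAtTwo` — ROADS (b)/(b″), (A₂): every seed has a subfield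
  `L ⊆ ℚ(W[4])` of `2`-power index (the cubic field `ℚ(e₁)`) whose cyclotomic `ℤ₂`-extensions have Iwasawa
  `μ = 0` — OPEN for `S₃`-cubics (Ferrero–Washington = abelian only); per-field numeric doors (Iwasawa 1956 /
  Fukuda 1994, `IwasawaTheory/ClassicalMuInvariant.lean`).
* ROAD (b″) (p595343 + `…FineRoadCoinvCrux`) — THE REGISTERED SECOND ROAD: `Δ`-coinvariants FIRST over
  `K = ℚ(i)`; stubs `stub_limAtTwo : LimAtTwo` (PRINT: Lim 2017 Thm. 3.5 at `2`), `stub_katoCoinvDataQiAtTwo :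
  KatoCoinvDataQiAtTwo` (K₂″: Kato's row over `ℚ(ζ_{2^∞})` with `Δ`-action, injective `Δ`-equivariant Coleman
  map to `Λ_G = Λ₀ × Λ₀` with FINITE cokernel (17.11), the images `(a,b)`, `(b,a)` of `z_{c,d}`, `c·z_{c,d}`
  (12.6) with `a + b = s·G₊`, `s ∉ (2)` (16.6 + `(c,d)`-factor), a descent map `X(E/K_∞)_Δ → X(E/ℚ_∞)` with
  finite cokernel, `X(E/K_∞)` f.g. torsion, and a fine comparison `fy : X₀(E/K_∞)_Δ → X₀(E/ℚ_∞)` in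
  ARCHIMEDEAN BALANCE `ℓ(ker fy) ≤ ℓ(ker fd)` (void for `Δ_E < 0`; Greenberg's real-place surjectivity for
  `Δ_E > 0`) — PRINT at `2` pending typing + the `×2` audit of (17.13.1); p595979 `…FineRoadCoinvCruxArch`),
  `stub_classicalMuSeedFieldsAtTwo : ClassicalMuSeedFieldsAtTwo` (A₂, OPEN); glue `stub_fineRoadCoinv`
  PROVED. Only the EVEN branch enters ((Λ_G/(a+bc))_Δ = Λ₀/(a+b)); no construction target at `(2)`.
* ROAD (b′) (p594161 + `…FineRoadQiCrux`, kept as PROVED glue `roadBQi_glue` over UNREGISTERED displayed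
  Props `KatoFineDataQiAtTwo` / `OddBranchMuZeroAtTwo` / `ConjAQiSeedsAtTwo`): the fine road run over
  `K = ℚ(i)` without taking coinvariants (Kato's own tower; no
  `Δ`-descent, no archimedean place; both branches enter through the determinant of `Λ_G = Λ₀[Δ]`):
  `stub_katoFineDataQiAtTwo : KatoFineDataQiAtTwo` (K₂′: Kato's (14.9.3)/(17.13.1) row over `ℚ(ζ_{2^∞})` for
  a `ℚ(i)`-model, injective `𝔏 : P → Λ_G` (17.11), integral classes `z_{c,d}`, `c·z_{c,d}` (12.6) with
  `𝔏 = a + bc`, `a ± b = s_±·G_±` (16.6; `s_±` the `(c,d)`-factors, outside `(2)`), finite-cokernel descent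
  `X(E/K_∞) → X(E/ℚ_∞)` — PRINT at `2` pending typing + ONE audit (the `×2` caveat of (17.13.1) over the
  totally imaginary tower); `stub_oddBranchMuZeroAtTwo : OddBranchMuZeroAtTwo` (Mu⁻: `μ(L₂⁻(E, χ₋₄, T)) = 0`
  on the seed cell — NEW analytic cell binder, finitely checkable per seed); `stub_conjAQiSeedsAtTwo :
  ConjAQiSeedsAtTwo` (A₂′: statement (A) at `2` for the `ℚ(i)`-models of the seeds — ⟸ Lim 2017 over
  `ℚ(i)` + Iwasawa 1973 + classical `μ = 0` of `ℚ(e₁)`; OPEN for `S₃` cubics).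
* `stub_equalityFromEnds : P → T → crux` — PROVED (p583329); `roadB_glue : P → Lim → K₂ → A₂ → T`,
  `roadBQi_glue : P → K₂′ → Mu⁻ → A₂′ → T` and `stub_fineRoadCoinv : P → Lim → K₂″ → A₂ → T` — PROVED
  (`…FineRoadCrux`, `…FineRoadQiCrux`, `…FineRoadCoinvCrux`).

GEN 3 (lead, skeleton v5 — the REGISTERED stub set is P, T, Kμ, Lim, MuIneq, PFμ):
* ROAD (c) — `stub_seedKatoMuPartAtTwo : SeedKatoMuPartAtTwo` (Kμ): «`X5.O1.KatoMuPartAtTwo W` for every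
  seed-cell curve» = Kato's missing `𝔭 = (2)` clause (Astérisque 295 Thm. 13.4 (3) / 17.4 (3), «assume further
  p ≠ 2») on the seed cell, in cell `bsd-2adic`'s typed currency; modulo P it is EQUIVALENT to T and to the crux
  (p597991 `…KatoMuRoad`: `seedMuZero_iff_seedKatoMuPartAtTwo`, `mainConjectureOfRankZeroBSDAtTwo_iff_seedKatoMuPartAtTwo`,
  and binder-free per curve `mazurMainConjecture_two_iff_katoMuPartAtTwo`). TARGET, not in print: Kato's own
  Euler-system paper (Kodai Math. J. 22 (1999)) Prop. 10.5 (4) — `Λ = O[[Gal(ℚ(ζ_{2^∞})/ℚ)]]` has no DVR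
  localisation at any `𝔭 ∋ 2`, so its Thm. 0.8 is empty there.
* ROAD (b″) RESHAPED after the attach seats and REF1 §57: the `∃`-over-Types data stub K₂″ certifies no
  provenance (att-p3 g2, `…FineRoadCoinvDataJunk`: K₂‴ ⟺ the bare inequality) and is DEMOTED to a displayed Prop
  with proved glue `muInequality_of_katoCoinvData`; the registered stub is the bare `μ`-INEQUALITY
  `stub_muInequalityAtTwo : MuInequalityAtTwo` (`ℓ₍₂₎(X(W/ℚ_∞)) ≤ ℓ₍₂₎(Λ/(G₊)) + ℓ₍₂₎(X₀(W/ℚ_∞))`, att-p3's shape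
  verbatim) — PRINT pending typing for `Δ_W < 0` (REF2 §43: (17.13.1) exact over `ℚ(ζ_{2^∞})`; REF1 §57: Kato's
  period factor `2^{[Δ_W>0]}` is `1`), a TARGET for `Δ_W > 0` (REF1 §57: Kato's best integral class gives only
  `a + b = u·2·G₊`; the missing unit is «`2 ∣ z_γ^{good}` in 𝐇¹» or an archimedean netting on the descent side —
  att-p4 g2 p597185 shows the balance `ℓ(ker fy) ≤ ℓ(ker fd)` is functorial and sign-free, so it nets nothing);
  A₂ is DEMOTED to a displayed Prop with proved glue from the registered POINT-FIELD form
  `stub_pointFieldMuAtTwo : PointFieldMuAtTwo` (att-p5 g2 p597201/p597544/`…TorsionPointFieldCrux`: every seed has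
  `P ≠ 0` in `W[2]` whose torsion-point field `ℚ(P)` — an `S₃`-cubic — has Iwasawa `μ₂ = 0`; OPEN class-wide,
  two class numbers per seed).

GEN 3, v6 (lead; after REF1 §57/§62, REF2 §46/§47, -ty p600292, att-p3/p4/p5 g3): road (b″) is NETTED — the registered
(b″) stubs are Limʳ `stub_limRelAtTwo` (typed-door shape: Iwasawa `μ₂ = 0` of the cyclotomic ℤ₂-tower of F = ℚ(W[2], ζ₄) ⟹
`ℓ₍₂₎(X₀^{rel∞}(W/ℚ_∞)) = 0` — PRINT-assembly Coates–Sujatha 3.4 / Lim 3.5 + genus theory (REF1 §62 (S2)), typing pending),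
MuIneqʳ `stub_muInequalityRelAtTwo` (the `μ`-inequality against the RELAXED-at-∞ fine dual `FineSelmerDualDataRelaxedInf`:
Kato 17.13 over ℚ(ζ_{2^∞}) + 17.11 + the netting «period 2^{[Δ>0]} against X^{rel}/X^{str} = (Λ/2)^{[Δ>0]}» (Greenberg LNM 1716
L.4.6) — PRINT pending typing, BOTH signs, no archimedean target), PFμ⁺ `stub_pointFieldMuCycAtTwo` (Iwasawa `μ₂ = 0` for the
cyclotomic ℤ₂-extensions of ℚ(W[2], ζ₄) for every seed — OPEN class-wide for `S₃`; per seed one Fukuda certificate). v5's MuIneq /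
PFμ stay as displayed Props with their proved glue.

GEN 4, v7 (lead `bsd-line-att-p2` g4; after att-p3 g3 p600554/p601402/p601771, att-p4 g3 p600921/`…FineRoadLocalArch`/
`…FineRoadRelaxedFine`, att-p5 g3 NARROW-A2 v2 + p601542, REF1 §65/§66, -ty p600292 accepted): the REGISTERED stub set is unchanged
(P / T / Kμ / Limʳ / MuIneqʳ / PFμ⁺ — no `stub-false`, no `stub-misstated`: att-p5 g3 «PFμ⁺ carrier F = ℚ(μ₄, E[2]) is CORRECT and
the SIMPLEST carrier for Limʳ»). NEW DISPLAY for the typer (-ty g6 queue item (7)): `KatoNetDataRelAtTwo` (K₂ⁿᵉᵗʳ) = att-p3 g3's netted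
road-(b″) data against the relaxed-at-∞ fine dual — Kato's row over `ℚ(ζ_{2^∞})` with `Δ`-action, injective `Δ`-equivariant Coleman
map with FINITE cokernel, zeta images with `a + b = 2^e·s·G₊` for SOME `e` (REF1 §57: `e = [Δ_W > 0]` for Kato's best integral
class), a RELAXED descent `fd : X'_Δ → X^{rel∞}` with finite cokernel, the archimedean extension `q : X^{rel∞} ↠ X(W/ℚ_∞)` with
`e ≤ ℓ₍₂₎(ker q)` (Greenberg LNM 1716 L.4.6: `ker q` is a quotient of `(Λ/2)^{[Δ>0]}` — the typed SHAPE, discharged by an embedding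
`(Λ/2)^e ↪ ker q`, att-p3 `natCast_le_lengthAt_of_injective`), and a fine comparison `fyʳ : X₀(W/K_∞)_Δ → X₀^{rel∞}(W/ℚ_∞)` with
`ℓ₍₂₎(ker fyʳ) = 0` (inf–res; no archimedean term for either sign, REF1 §62 (ii)) — with PROVED glue
`muInequalityRel_of_katoNetDataRel` (p601771 `…FineRoad.muInequalityRelAtTwo_of_katoNetDataRel`) and composition `…_of_roadB2net`.
As every `∃`-over-Types shape it certifies no provenance (att-p3 g2 `…CoinvDataJunk`), so MuIneqʳ stays the registered stub and K₂ⁿᵉᵗʳ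
is the typing target. LOCAL BRICKS now in the kernel (att-p4 g3): `Sel₀ = Sel ⊓ (trivial above 2)` with NO archimedean term over `ℚ`
at `p = 2` (`LocalAway.fineSelmerInfty_eq_selmerInfty_inf`, `LocalArch.fineSelmerInfty_eq_selmerInfty_inf_rat_two`); the restriction
`r : X₀^{rel∞} ↠ X₀` exists, is onto, `ker r` is killed by `2`, and for `Δ_W < 0` it is an ISOMORPHISM
(`RelaxedRestrict.lengthAt_relaxed_eq_of_Δ_neg`): on the `Δ_W < 0` half of the seed cell (all 12 certified seeds) Limʳ ⟺ (A) and
MuIneqʳ ⟺ MuIneq datum by datum, so there Limʳ is the typed PRINT fact `LimAtTwo` applied to `L = ℚ(P)` (att-p5: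
`fixedField_stabilizer_le_divisionField_four`, `2`-power index) under PFμ (cubic carrier). TYPING TARGETS displayed for -ty:
(Limʳ-door) «`ClassicalMuVanishes` of every cyclotomic `ℤ₂`-extension of `F = ℚ(W[2], i)` ⟹ `ℓ₍₂₎(Yr.X) = 0` for every cyclotomic
`(κ, γ)` and every `Yr : W.FineSelmerDualDataRelaxedInf κ γ`» = Lim 2017 Thm 3.5 with base `L = F` (`F(μ₄, E[2]) = F`, `k = 0`; F
totally imaginary, so Lemmas 3.3/3.4 apply as printed, [Iw73] never invoked) + Lemma 3.2's inf–res down to `ℚ^{cyc}` with the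
RELAXED-at-∞ receptacle (the restriction of a relaxed-at-∞ fine class to the totally imaginary `F^{cyc}` IS fine; kernel
`⊂ H¹(F^{cyc}/ℚ^{cyc}, E(F^{cyc})[2^∞])` finite); (K₂ⁿᵉᵗʳ) the body of `KatoNetDataRelAtTwo` below, conjunct by conjunct: Kato 17.4 (1)
over `ℚ(i)` (torsion), Prop 17.11 (Coleman map, cokernel of `(2)`-length `0` — every good ordinary `2` is anomalous), Thm 12.5/12.6
with (17.13.1) exact over `ℚ(ζ_{2^∞})` (REF2 §43), Thm 16.6 (`a + b = 2^e·s·G₊`), Greenberg L.4.6 (`e ≤ ℓ(ker q)`), inf–res (`fyʳ`).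
GEN 4, v8 (lead, after att-p5 g4 p605654/p605868/p606004 + the Literature door p605725): stub Limʳ is CLOSED BY NAME modulo ONE
named fact — `limRel_glue : LimUpstairsDoorAtTwo → LimRelAtTwo` is att-p5 g4's `…FineRoad.LimRelUpstairs.limRelAtTwo_of_lim2017`
(kernel descent: 2-torsion inflation–restriction `finite_pTorsion_ker_resOfLe`, res : Sel₀^{rel∞}(ℚ_∞) → Sel₀(ℚ(E[2],μ_{2^∞})) defined,
`lengthAt_relaxed_eq_zero_of_finite_pTorsion`), where `LimUpstairsDoorAtTwo` DISPLAYS the tree's statement-only fact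
`Lim2017.thm35_at_two_upstairs_fineSelmer_twoTorsion_finite_of_classicalMuVanishes` (Lim 2017 Thm 3.5 «if» at `p = 2` for the carrier
`F = ℚ(E[2], √−1) = F(μ₄, E[2])` itself; accepted p605725). The REGISTERED stub set becomes P / T / Kμ / LimDoor (`stub_limUpstairsDoorAtTwo`,
PRINT, conditional for ever — same status as P) / MuIneqʳ / PFμ⁺; road (b″) now reads «C2 ⟸ PRINT{P, LimDoor} + MuIneqʳ (typing) + PFμ⁺
(OPEN)» by name. Lead note PERFECT-DESCENT.md (crux workfile): (A)₂(E/ℚ) ⟺ μ₂(ℚ(E[2])) = 0 for S₃ image (E[2] = Steinberg module,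
projective over 𝔽₂[S₃]; FW for ℚ(√Δ)); att-p3 g4 kernelises its §2/§3(i)(ii). NECESSITY BY NAME (lead, p607593
`…MuNecessity` + the Literature door p607299 `Literature.NumberTheory.EllipticCurves.prop416_…` = Greenberg 2011 Prop 4.1.6 +
Rem 4.1.7 at `p = 2`, in-print assembly, REF2 v17 §3): `necessity_classicalMu_divisionField_two` below — P (period unit,
modularity) + the door + the CRUX ⟹ Iwasawa's `μ₂ = 0` for the cyclotomic `ℤ₂`-extension of `ℚ(W[2])` for EVERY seed-cell `W`
with `BSD(W, 2)`: the ∀-`W` crux as filed contains the classical `μ₂`-statement for an infinite family of `S₃`-sextics.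
GEN 4, v9 (lead, p608587 `…SexticCriterion`): THE SEXTIC CRITERION by name — `sexticCriterion_negDisc` below: granted P, the
Lim door `LimAtTwo` (carrier `L = ℚ(W[2]) ≤ ℚ(W[4])`, 2-power index proved there), the Greenberg door and MuIneqʳ, the crux RESTRICTED
TO `Δ_W < 0` (75 % of the cell; all 12 certified seeds) is EQUIVALENT to «μ₂ = 0 for the cyclotomic ℤ₂-tower of ℚ(W[2]) for every such W».

Compositions `MainConjectureOfRankZeroBSDAtTwo_of` (road (a)), `…_of_roadC`, `…_of_roadB2rel` (registered), `…_of_roadB2net`,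
`…_of_roadB2ineq`, and `…_of_roadB`, `…_of_roadBQi`, `…_of_roadB2` (displayed) conclude the crux BY NAME. BSD is not proved by any
of this. -/

set_option linter.dupNamespace false

noncomputable section

namespace Summit.BirchSwinnertonDyer.BirchSwinnertonDyer.Cruxes.MainConjectureOfRankZeroBSDAtTwo.Birth

open Summit.BirchSwinnertonDyer.BirchSwinnertonDyer.Theses.AlignedTransportAtTwo
open WeierstrassCurve Summit.BirchSwinnertonDyer.Rank1Residual.X5
open Literature.NumberTheory.EllipticCurves Literature.NumberTheory.EllipticCurves.ModularForms CongruenceSubgroup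
  Literature.NumberTheory.EllipticCurves.Greenberg1999 Literature.NumberTheory.IwasawaTheory
  Summit.BirchSwinnertonDyer.Rank1Residual.F1Sign2 Summit.BirchSwinnertonDyer.Rank1Residual.X1.MuLambda
  Summit.BirchSwinnertonDyer.BirchSwinnertonDyer.Theorems.Rank1ResidualX1Defs

/-- PRINT: the published named facts of the tree consumed by the converse chain at `2` — Kato 2004 Thm. 17.4
(1)(2) at `p = 2` for every curve (`kato_divisibility_allPrimes`), Greenberg 1999 Thm. 4.1 parity-free
(`thm41_charValue_rankZero_anyPrime`), the period unit at `2` for `E[2]` irreducible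
(`realPeriodRat_eq_unit_mul_plusPeriod_two`, Abbes–Ullmo Thm. A), modularity (`nonempty_modularParametrizationData`),
Gross–Zagier–Kolyvagin (`rank_eq_analyticRank_of_analyticRank_le_one`). Nothing asserted. -/
def PublishedInputsAtTwo : Prop :=
  (∀ (V : WeierstrassCurve ℚ) [V.IsElliptic] [V.IsGloballyMinimal] [NeZero (V.conductorNorm ℤ)]
      (f : CuspForm (Gamma0 (V.conductorNorm ℤ)) 2), kato_divisibility_allPrimes V 2 (f := f)) ∧
    thm41_charValue_rankZero_anyPrime ∧ realPeriodRat_eq_unit_mul_plusPeriod_two ∧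
    nonempty_modularParametrizationData ∧ rank_eq_analyticRank_of_analyticRank_le_one

/-- OPEN (road (a)): `μ₂(X(W/ℚ_∞)) = 0` for every seed-cell curve `W` (non-CM, good ordinary at `2`, no
rational point of order `2`, `Δ ∉ ℚ²`, `r_an = 0`, analytic `μ₂ = 0`, `BSD(W,2)`) and every `Λ`-torsion
cyclotomic dual datum — the `p = 2`, seed-cell instance of Greenberg's Conj. 1.11
(`Rank1Residual.GreenbergMuConjectureIrreducible`). Nothing asserted. -/
def SeedMuZeroAtTwo : Prop :=
  ∀ (W : WeierstrassCurve ℚ) [W.IsElliptic] [W.IsGloballyMinimal], ¬ W.HasCM →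
    IsOrdinaryAt W 2 → (∀ x : ℚ, ¬ HasRationalTwoTorsionX W x) → ¬ IsSquare W.Δ →
    W.analyticRank = 0 →
    (∀ ⦃N : ℕ⦄ [NeZero N] (f : CuspForm (Gamma0 N) 2), IsNewformOf W f →
      ∀ G : IwasawaAlgebra 2, IsEvenBranchLiftAtTwo W f G → red G ≠ 0) →
    BSDp W 2 →
    ∀ (κ : ZpExtension ℚ 2) (γ : Field.absoluteGaloisGroup ℚ), κ.IsCyclotomic →
      κ.IsTopGenerator γ → IsCyclotomicVariable 2 γ →
      ∀ D : W.SelmerDualData κ γ, D.IsTorsion → D.mu = 0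

/-- PRINT (road (b)): Lim 2017, Thm. 3.5 with Lemma 3.2 at `p = 2` — the tree's named fact
`Lim2017.thm35_at_two_fineSelmerDual_moduleFinite_of_classicalMuVanishes_of_le_divisionField_four`
(statement (A) at `(E,2)` from Iwasawa's `μ = 0` of a `2`-power-index subfield of `ℚ(E[4])`). Nothing asserted. -/
def LimAtTwo : Prop :=
  Lim2017.thm35_at_two_fineSelmerDual_moduleFinite_of_classicalMuVanishes_of_le_divisionField_four

/-- TARGET (road (b), (K₂)): Kato's §17.13 data at GOOD ORDINARY `2` in fine form — for every globally minimal
`W` good ordinary at `2` with no rational point of order `2`, every cyclotomic datum `(κ, γ)`, every newform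
`f` of `W`, every integral lift `G` of `L₂(f, α)` and all Pontryagin-dual data `D` (of `Sel_{2^∞}`) and `Yd`
(of the fine part): abstract `Λ`-modules `H, P` with `loc : H → P`, `toX : P → X`, `π : X → X₀`,
`toX ∘ loc = 0`, `P → X → X₀` exact at `X`, an INJECTIVE Coleman map `col : P → Λ` and a class `z` with
`col (loc z) = s·G`, `s ∉ (2)` (NO `2`-power defect). Not in print at `𝔭 = (2)`. Nothing asserted. -/
def KatoFineDataAtTwo : Prop :=
  ∀ (W : WeierstrassCurve ℚ) [W.IsElliptic] [W.IsGloballyMinimal], IsOrdinaryAt W 2 →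
    (∀ x : ℚ, ¬ HasRationalTwoTorsionX W x) →
    ∀ (κ : ZpExtension ℚ 2) (γ : Field.absoluteGaloisGroup ℚ), κ.IsCyclotomic →
    κ.IsTopGenerator γ → IsCyclotomicVariable 2 γ →
    ∀ ⦃N : ℕ⦄ [NeZero N] (f : CuspForm (Gamma0 N) 2), IsNewformOf W f →
    ∀ G : IwasawaAlgebra 2, iwasawaToPowerSeries 2 G = padicLFunction f (unitRoot W 2 : ℚ_[2]) →
    ∀ (D : W.SelmerDualData κ γ) (Yd : W.FineSelmerDualData κ γ),
      ∃ (H P : Type) (_ : AddCommGroup H) (_ : _root_.Module (IwasawaAlgebra 2) H)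
        (_ : AddCommGroup P) (_ : _root_.Module (IwasawaAlgebra 2) P)
        (loc : H →ₗ[IwasawaAlgebra 2] P) (toX : P →ₗ[IwasawaAlgebra 2] D.X)
        (π : D.X →ₗ[IwasawaAlgebra 2] Yd.X) (col : P →ₗ[IwasawaAlgebra 2] IwasawaAlgebra 2)
        (z : H) (s : IwasawaAlgebra 2),
        Function.Injective col ∧ (∀ h, toX (loc h) = 0) ∧ Function.Exact toX π ∧
          s ∉ IwasawaAlgebra.augIdealP 2 ∧ col (loc z) = s * G

/-- OPEN (road (b), (A₂)): every seed-cell curve `W` has a subfield `L ⊆ ℚ(W[4])` of `2`-power index (the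
cubic field of a root of its `2`-division cubic) all of whose cyclotomic `ℤ₂`-extensions have Iwasawa
`μ = 0` (`ClassicalMuVanishes`, growth form). Iwasawa's conjecture for `S₃`-cubics — OPEN; Ferrero–Washington
covers abelian `L`. Nothing asserted. -/
def ClassicalMuSeedFieldsAtTwo : Prop :=
  ∀ (W : WeierstrassCurve ℚ) [W.IsElliptic] [W.IsGloballyMinimal], ¬ W.HasCM →
    IsOrdinaryAt W 2 → (∀ x : ℚ, ¬ HasRationalTwoTorsionX W x) → ¬ IsSquare W.Δ →
    W.analyticRank = 0 → BSDp W 2 →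
    ∃ L : IntermediateField ℚ (AlgebraicClosure ℚ), L ≤ W.divisionField 4 ∧
      (∃ k : ℕ, Module.finrank ℚ (W.divisionField 4) = 2 ^ k * Module.finrank ℚ L) ∧
      ∀ κL : ZpExtension L 2, κL.IsCyclotomic → ClassicalMuVanishes κL

/-- TARGET-by-typing (road (b′), (K₂′)): Kato's §17.13 data for a `ℚ(i)`-model of `W` over the totally
imaginary tower `ℚ(ζ_{2^∞})` — quadratic `K` with `d_K = −4`, a `K`-model `V'`, a cyclotomic datum over `K`,
a dual fine Selmer datum `Yd_K`, the Poitou–Tate row `H → P → X' → Yd_K`, an injective Coleman map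
`col : P → Λ₀ × Λ₀`, two zeta classes with `col (loc z₁) = (a,b)`, `col (loc z₂) = (b,a)`, `a + b = s₊·G₊`,
`a − b = s₋·G₋` (`G_±` the integral lifts of the two branches, `s_± ∉ (2)`), a descent map `X' → X(W/ℚ_∞)`
with finite cokernel. Printed at `p = 2` modulo typing and the `×2` audit; nothing asserted. -/
def KatoFineDataQiAtTwo : Prop :=
  ∀ (W : WeierstrassCurve ℚ) [W.IsElliptic] [W.IsGloballyMinimal], IsOrdinaryAt W 2 →
    (∀ x : ℚ, ¬ HasRationalTwoTorsionX W x) →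
    ∀ (κ : ZpExtension ℚ 2) (γ : Field.absoluteGaloisGroup ℚ), κ.IsCyclotomic →
    κ.IsTopGenerator γ → IsCyclotomicVariable 2 γ →
    ∀ ⦃N : ℕ⦄ [NeZero N] (f : CuspForm (Gamma0 N) 2), IsNewformOf W f →
    ∀ Gp Gm : IwasawaAlgebra 2,
      iwasawaToPowerSeries 2 Gp = padicLFunction f (unitRoot W 2 : ℚ_[2]) →
      iwasawaToPowerSeries 2 Gm = padicLFunctionMinusBranch f (unitRoot W 2 : ℚ_[2]) 1 →
    ∀ D : W.SelmerDualData κ γ,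
      ∃ (K : Type) (_ : Field K) (_ : NumberField K) (V' : WeierstrassCurve K)
        (κK : ZpExtension K 2) (γK : Field.absoluteGaloisGroup K) (YdK : V'.FineSelmerDualData κK γK)
        (H P X' : Type) (_ : AddCommGroup H) (_ : _root_.Module (IwasawaAlgebra 2) H)
        (_ : AddCommGroup P) (_ : _root_.Module (IwasawaAlgebra 2) P)
        (_ : AddCommGroup X') (_ : _root_.Module (IwasawaAlgebra 2) X')
        (loc : H →ₗ[IwasawaAlgebra 2] P) (toX : P →ₗ[IwasawaAlgebra 2] X')
        (π : X' →ₗ[IwasawaAlgebra 2] YdK.X)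
        (col : P →ₗ[IwasawaAlgebra 2] IwasawaAlgebra 2 × IwasawaAlgebra 2)
        (z₁ z₂ : H) (a b sp sm : IwasawaAlgebra 2) (fd : X' →ₗ[IwasawaAlgebra 2] D.X),
        Module.finrank ℚ K = 2 ∧ NumberField.discr K = -4 ∧
        (∃ C : WeierstrassCurve.VariableChange K, C • W.baseChange K = V') ∧ κK.IsCyclotomic ∧
        κK.IsTopGenerator γK ∧
        Function.Injective col ∧ (∀ h, toX (loc h) = 0) ∧ Function.Exact toX π ∧
        col (loc z₁) = (a, b) ∧ col (loc z₂) = (b, a) ∧ a + b = sp * Gp ∧ a - b = sm * Gm ∧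
        sp ∉ IwasawaAlgebra.augIdealP 2 ∧ sm ∉ IwasawaAlgebra.augIdealP 2 ∧
        Finite (D.X ⧸ LinearMap.range fd)

/-- NEW CELL BINDER (road (b′), (Mu⁻)): the ODD-branch analytic `μ₂ = 0` on the seed cell — every integral lift
`G₋` of `L₂⁻(f, α, ω, T)` (`ω = χ₋₄`; the lift exists at good ordinary `2`) has `red G₋ ≠ 0`. Finitely
checkable per seed (modular symbols on `[·]⁻`); expected on the cell; nothing asserted. -/
def OddBranchMuZeroAtTwo : Prop :=
  ∀ (W : WeierstrassCurve ℚ) [W.IsElliptic] [W.IsGloballyMinimal], ¬ W.HasCM →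
    IsOrdinaryAt W 2 → (∀ x : ℚ, ¬ HasRationalTwoTorsionX W x) → ¬ IsSquare W.Δ →
    W.analyticRank = 0 → BSDp W 2 →
    ∀ ⦃N : ℕ⦄ [NeZero N] (f : CuspForm (Gamma0 N) 2), IsNewformOf W f →
    ∀ Gm : IwasawaAlgebra 2,
      iwasawaToPowerSeries 2 Gm = padicLFunctionMinusBranch f (unitRoot W 2 : ℚ_[2]) 1 → red Gm ≠ 0

/-- OPEN (road (b′), (A₂′)): statement (A) at `2` for the `ℚ(i)`-models of seed-cell curves
(`Sel₀(K_∞, E[2^∞])[2]` finite, `K = ℚ(i)`) — ⟸ Lim 2017 Thm. 3.5 over `ℚ(i)` + Iwasawa 1973 + classical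
`μ = 0` of the cubic field `ℚ(e₁)` (not typed for base `ℚ(i)`); nothing asserted. -/
def ConjAQiSeedsAtTwo : Prop :=
  ∀ (W : WeierstrassCurve ℚ) [W.IsElliptic] [W.IsGloballyMinimal], ¬ W.HasCM →
    IsOrdinaryAt W 2 → (∀ x : ℚ, ¬ HasRationalTwoTorsionX W x) → ¬ IsSquare W.Δ →
    W.analyticRank = 0 → BSDp W 2 →
    ∀ (K : Type) [Field K] [NumberField K] (V' : WeierstrassCurve K),
      Module.finrank ℚ K = 2 → NumberField.discr K = -4 →
      (∃ C : WeierstrassCurve.VariableChange K, C • W.baseChange K = V') →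
      ∀ κK : ZpExtension K 2, κK.IsCyclotomic → Set.Finite {s : V'.fineSelmerInfty κK | 2 • s = 0}

/-- TARGET-by-typing (road (b″), (K₂″)): Kato's row over `ℚ(ζ_{2^∞})` for `W` with `Δ`-action (`c` on
`P`, `X' = X(E/K_∞)`, `Y' = X₀(E/K_∞)`, `K = ℚ(i)`), an injective `Δ`-equivariant Coleman map `col : P → Λ₀ × Λ₀`
(`= Λ_G`, `c` ↦ swap) with FINITE cokernel, the zeta images `w₁ ↦ (a,b)`, `w₂ ↦ (b,a)` in `ker toX` with
`a + b = s·G₊` (`G₊` the integral lift of `L₂(f, α)`, `s ∉ (2)`), a descent map `X'_Δ → X(W/ℚ_∞)` with finite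
cokernel, `X'` finitely generated torsion (Kato 17.4 (1) over `ℚ(i)`), and a fine comparison
`fy : Y'_Δ → X₀(W/ℚ_∞)` in ARCHIMEDEAN BALANCE with the descent map: `ℓ_{(2)}(ker fy) ≤ ℓ_{(2)}(ker fd)` (void
for `Δ_W < 0`; for `Δ_W > 0` Greenberg's real-place surjectivity at `2`). PRINT at `2` pending typing + the
`×2` audit of (17.13.1); nothing asserted. -/
def KatoCoinvDataQiAtTwo : Prop :=
  ∀ (W : WeierstrassCurve ℚ) [W.IsElliptic] [W.IsGloballyMinimal], IsOrdinaryAt W 2 →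
    (∀ x : ℚ, ¬ HasRationalTwoTorsionX W x) →
    ∀ (κ : ZpExtension ℚ 2) (γ : Field.absoluteGaloisGroup ℚ), κ.IsCyclotomic →
    κ.IsTopGenerator γ → IsCyclotomicVariable 2 γ →
    ∀ ⦃N : ℕ⦄ [NeZero N] (f : CuspForm (Gamma0 N) 2), IsNewformOf W f →
    ∀ Gp : IwasawaAlgebra 2, iwasawaToPowerSeries 2 Gp = padicLFunction f (unitRoot W 2 : ℚ_[2]) →
    ∀ (D : W.SelmerDualData κ γ) (Yd : W.FineSelmerDualData κ γ),
      ∃ (P X' Y' : Type) (_ : AddCommGroup P) (_ : _root_.Module (IwasawaAlgebra 2) P)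
        (_ : AddCommGroup X') (_ : _root_.Module (IwasawaAlgebra 2) X')
        (_ : AddCommGroup Y') (_ : _root_.Module (IwasawaAlgebra 2) Y')
        (toX : P →ₗ[IwasawaAlgebra 2] X') (π : X' →ₗ[IwasawaAlgebra 2] Y')
        (cP : P →ₗ[IwasawaAlgebra 2] P) (cX : X' →ₗ[IwasawaAlgebra 2] X')
        (cY : Y' →ₗ[IwasawaAlgebra 2] Y')
        (col : P →ₗ[IwasawaAlgebra 2] IwasawaAlgebra 2 × IwasawaAlgebra 2) (w₁ w₂ : P)
        (a b s : IwasawaAlgebra 2) (fd : (X' ⧸ LinearMap.range (cX - 1)) →ₗ[IwasawaAlgebra 2] D.X)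
        (fy : (Y' ⧸ LinearMap.range (cY - 1)) →ₗ[IwasawaAlgebra 2] Yd.X),
        Function.Exact toX π ∧ Function.Surjective π ∧ toX ∘ₗ cP = cX ∘ₗ toX ∧ π ∘ₗ cX = cY ∘ₗ π ∧
        Function.Injective col ∧
        col ∘ₗ cP = (LinearEquiv.prodComm (IwasawaAlgebra 2) (IwasawaAlgebra 2) (IwasawaAlgebra 2) :
          IwasawaAlgebra 2 × IwasawaAlgebra 2 →ₗ[IwasawaAlgebra 2]
            IwasawaAlgebra 2 × IwasawaAlgebra 2) ∘ₗ col ∧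
        Finite ((IwasawaAlgebra 2 × IwasawaAlgebra 2) ⧸ LinearMap.range col) ∧
        toX w₁ = 0 ∧ toX w₂ = 0 ∧ col w₁ = (a, b) ∧ col w₂ = (b, a) ∧
        s ∉ IwasawaAlgebra.augIdealP 2 ∧ a + b = s * Gp ∧
        Module.Finite (IwasawaAlgebra 2) X' ∧ Module.IsTorsion (IwasawaAlgebra 2) X' ∧
        Finite (D.X ⧸ LinearMap.range fd) ∧
        Literature.NumberTheory.EllipticCurves.Module.lengthAt (IwasawaAlgebra 2) (LinearMap.ker fy)
            ⟨IwasawaAlgebra.augIdealP 2, IwasawaAlgebra.isPrime_augIdealP_holds 2⟩ ≤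
          Literature.NumberTheory.EllipticCurves.Module.lengthAt (IwasawaAlgebra 2) (LinearMap.ker fd)
            ⟨IwasawaAlgebra.augIdealP 2, IwasawaAlgebra.isPrime_augIdealP_holds 2⟩

/-- TARGET (road (c), (Kμ)): the `𝔭 = (2)` clause of Kato's divisibility — cell `bsd-2adic`'s typed residual
`X5.O1.KatoMuPartAtTwo W` (`2^{μ(X(W/ℚ_∞))} ∣ L₀` for every integral `L₀` with `ι L₀ = ϖ·L₂(f, α)`) — for every
seed-cell curve `W`. Modulo P it is EQUIVALENT to T and to the crux (`…KatoMuRoad`). NOT in print (Astérisque 295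
Thm. 13.4 (3) «assume further p ≠ 2»; Kodai Math. J. 22 Prop. 10.5 (4)). Nothing asserted. -/
def SeedKatoMuPartAtTwo : Prop :=
  ∀ (W : WeierstrassCurve ℚ) [W.IsElliptic] [W.IsGloballyMinimal], ¬ W.HasCM →
    IsOrdinaryAt W 2 → (∀ x : ℚ, ¬ HasRationalTwoTorsionX W x) → ¬ IsSquare W.Δ →
    W.analyticRank = 0 →
    (∀ ⦃N : ℕ⦄ [NeZero N] (f : CuspForm (Gamma0 N) 2), IsNewformOf W f →
      ∀ G : IwasawaAlgebra 2, IsEvenBranchLiftAtTwo W f G → red G ≠ 0) →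
    BSDp W 2 → O1.KatoMuPartAtTwo W

/-- ROAD (b″) REGISTERED STUB (MuIneq): Kato's `μ`-inequality at `2` WITHOUT the Euler-system clause —
`ℓ₍₂₎(X(W/ℚ_∞)) ≤ ℓ₍₂₎(Λ/(G₊)) + ℓ₍₂₎(X₀(W/ℚ_∞))` for every `W` good ordinary at `2` with no rational `2`-torsion,
every cyclotomic datum, every newform `f` of `W`, every integral lift `G₊` of `L₂(f, α)` and all dual data (the
bare content of K₂″/K₂‴; att-p3 g2's shape verbatim). PRINT pending typing for `Δ_W < 0`; a TARGET for `Δ_W > 0`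
(REF1 §57: Kato's integral classes carry `2^{[Δ_W > 0]}`). Nothing asserted. -/
def MuInequalityAtTwo : Prop :=
  ∀ (W : WeierstrassCurve ℚ) [W.IsElliptic] [W.IsGloballyMinimal], IsOrdinaryAt W 2 →
    (∀ x : ℚ, ¬ HasRationalTwoTorsionX W x) →
    ∀ (κ : ZpExtension ℚ 2) (γ : Field.absoluteGaloisGroup ℚ), κ.IsCyclotomic →
    κ.IsTopGenerator γ → IsCyclotomicVariable 2 γ →
    ∀ ⦃N : ℕ⦄ [NeZero N] (f : CuspForm (Gamma0 N) 2), IsNewformOf W f →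
    ∀ Gp : IwasawaAlgebra 2, iwasawaToPowerSeries 2 Gp = padicLFunction f (unitRoot W 2 : ℚ_[2]) →
    ∀ (D : W.SelmerDualData κ γ) (Yd : W.FineSelmerDualData κ γ),
      Literature.NumberTheory.EllipticCurves.Module.lengthAt (IwasawaAlgebra 2) D.X
          ⟨IwasawaAlgebra.augIdealP 2, IwasawaAlgebra.isPrime_augIdealP_holds 2⟩ ≤
        Literature.NumberTheory.EllipticCurves.Module.lengthAt (IwasawaAlgebra 2)
            (IwasawaAlgebra 2 ⧸ Ideal.span {Gp})
            ⟨IwasawaAlgebra.augIdealP 2, IwasawaAlgebra.isPrime_augIdealP_holds 2⟩ +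
          Literature.NumberTheory.EllipticCurves.Module.lengthAt (IwasawaAlgebra 2) Yd.X
            ⟨IwasawaAlgebra.augIdealP 2, IwasawaAlgebra.isPrime_augIdealP_holds 2⟩

/-- ROAD (b″) REGISTERED STUB (PFμ), A₂ in point-field form (att-p5 g2): every seed-cell curve `W` has a non-zero
`P ∈ W[2]` such that every cyclotomic `ℤ₂`-extension of the torsion-point field `ℚ(P) = ℚ̄^{Stab P}` (the
`S₃`-cubic `ℚ(e₁)`) has Iwasawa `μ = 0` in growth form (`ClassicalMuVanishes`). Iwasawa's `μ`-conjecture at `2`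
for `S₃`-cubics — OPEN class-wide (Ferrero–Washington is abelian only); per seed two class numbers (Fukuda /
Iwasawa doors in `…TorsionPointFieldDoors`). Nothing asserted. -/
def PointFieldMuAtTwo : Prop :=
  ∀ (W : WeierstrassCurve ℚ) [W.IsElliptic] [W.IsGloballyMinimal], ¬ W.HasCM →
    IsOrdinaryAt W 2 → (∀ x : ℚ, ¬ HasRationalTwoTorsionX W x) → ¬ IsSquare W.Δ →
    W.analyticRank = 0 → BSDp W 2 →
    ∃ P : geomTorsion W 2, P ≠ 0 ∧
      ∀ κL : ZpExtension
          (IntermediateField.fixedField (MulAction.stabilizer (Field.absoluteGaloisGroup ℚ) P)) 2,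
        κL.IsCyclotomic → ClassicalMuVanishes κL

/-- PRINT (road (b″) netted, v8): the tree's statement-only named fact
`Lim2017.thm35_at_two_upstairs_fineSelmer_twoTorsion_finite_of_classicalMuVanishes` (Lim 2017 Thm. 3.5 «if» at `p = 2` for
`L = F := ℚ(E[2], √−1) = F(μ₄, E[2])` itself: Iwasawa's `μ₂ = 0` for the cyclotomic `ℤ₂`-extension of `F` ⟹ `Sel₀(F^{cyc}, E[2^∞])[2]`
finite; accepted p605725, att-p5 g4). Displayed so that stub LimDoor is registered by name. Nothing asserted. -/
def LimUpstairsDoorAtTwo : Prop :=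
  Lim2017.thm35_at_two_upstairs_fineSelmer_twoTorsion_finite_of_classicalMuVanishes

/-- ROAD (b″) NETTED, DISPLAYED (Limʳ; registered in v6/v7, PROVED GLUE from v8 on — `limRel_glue`): the typed-door shape «Iwasawa `μ₂ = 0` (growth form) for every cyclotomic
`ℤ₂`-extension of `F = ℚ(W[2], ζ₄)` ⟹ `ℓ₍₂₎(X₀^{rel∞}(W/ℚ_∞)) = 0` for every relaxed-at-∞ fine dual datum», for `W` good ordinary at
`2` with no rational `2`-torsion. PRINT-assembly, typing pending (-ty g6 (7); REF1 §62 (S2), §65 cleared the receptacle): Lim 2017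
Thm 3.5 with base `L = F` (`F(μ₄, E[2]) = F`, `k = 0`; `F` totally imaginary, so Lemmas 3.3/3.4 apply as printed and no [Iw73]
ascent is invoked — att-p5 g3, REF1 §66) + Lemma 3.2's inf–res down to `ℚ^{cyc}` INTO THE RELAXED-at-∞ receptacle (a relaxed-at-∞
fine class of `ℚ_∞` restricts to a fine class of the totally imaginary `F^{cyc}`; kernel `⊂ H¹(F^{cyc}/ℚ^{cyc}, E(F^{cyc})[2^∞])`
finite). No genus theory needed. On the `Δ_W < 0` half-cell `X₀^{rel∞} ≅ X₀` (att-p4 g3 `RelaxedRestrict.lengthAt_relaxed_eq_of_Δ_neg`)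
and the conclusion is the typed PRINT fact `LimAtTwo` for `L = ℚ(P)` under the cubic hypothesis PFμ. Nothing asserted. -/
def LimRelAtTwo : Prop :=
  ∀ (W : WeierstrassCurve ℚ) [W.IsElliptic] [W.IsGloballyMinimal], IsOrdinaryAt W 2 →
    (∀ x : ℚ, ¬ HasRationalTwoTorsionX W x) →
    ∀ i : AlgebraicClosure ℚ, i ^ 2 = -1 →
    (∀ κL : ZpExtension ↥(W.divisionField 2 ⊔ IntermediateField.adjoin ℚ {i}) 2,
      κL.IsCyclotomic → ClassicalMuVanishes κL) →
    ∀ (κ : ZpExtension ℚ 2) (γ : Field.absoluteGaloisGroup ℚ), κ.IsCyclotomic →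
    κ.IsTopGenerator γ → IsCyclotomicVariable 2 γ →
    ∀ Yr : W.FineSelmerDualDataRelaxedInf κ γ,
      Literature.NumberTheory.EllipticCurves.Module.lengthAt (IwasawaAlgebra 2) Yr.X
          ⟨IwasawaAlgebra.augIdealP 2, IwasawaAlgebra.isPrime_augIdealP_holds 2⟩ = 0

/-- ROAD (b″) NETTED, REGISTERED STUB (MuIneqʳ): Kato's `μ`-inequality at `2` against the RELAXED-at-∞ fine dual —
`ℓ₍₂₎(X(W/ℚ_∞)) ≤ ℓ₍₂₎(Λ/(G₊)) + ℓ₍₂₎(X₀^{rel∞}(W/ℚ_∞))` for every `W` good ordinary at `2` with no rational `2`-torsion, every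
cyclotomic datum, newform, integral lift `G₊` of `L₂(f, α)`, every `D : SelmerDualData` and `Yr : FineSelmerDualDataRelaxedInf`.
PRINT pending typing for BOTH signs of `Δ_W` (Kato §17.13 over `ℚ(ζ_{2^∞})`, Prop 17.11, REF1 §57 period `2^{[Δ>0]}` netted
against Greenberg's `X^{rel∞}/X^{str} = (Λ/2)^{[Δ>0]}`, LNM 1716 L.4.6; crux notes ARCH-NETTING.md / ARCH-NETTING-att-p3.md; kernel
p600554 `lengthAt_le_of_coinvDatum_netting`). Supplied VERBATIM from the displayed data `KatoNetDataRelAtTwo` by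
`muInequalityRel_of_katoNetDataRel` (p601771). For `Δ_W < 0` it is the v5 inequality `MuInequalityAtTwo` datum by datum
(`RelaxedRestrict.lengthAt_relaxed_eq_of_Δ_neg`). Nothing asserted. -/
def MuInequalityRelAtTwo : Prop :=
  ∀ (W : WeierstrassCurve ℚ) [W.IsElliptic] [W.IsGloballyMinimal], IsOrdinaryAt W 2 →
    (∀ x : ℚ, ¬ HasRationalTwoTorsionX W x) →
    ∀ (κ : ZpExtension ℚ 2) (γ : Field.absoluteGaloisGroup ℚ), κ.IsCyclotomic →
    κ.IsTopGenerator γ → IsCyclotomicVariable 2 γ →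
    ∀ ⦃N : ℕ⦄ [NeZero N] (f : CuspForm (Gamma0 N) 2), IsNewformOf W f →
    ∀ Gp : IwasawaAlgebra 2, iwasawaToPowerSeries 2 Gp = padicLFunction f (unitRoot W 2 : ℚ_[2]) →
    ∀ (D : W.SelmerDualData κ γ) (Yr : W.FineSelmerDualDataRelaxedInf κ γ),
      Literature.NumberTheory.EllipticCurves.Module.lengthAt (IwasawaAlgebra 2) D.X
          ⟨IwasawaAlgebra.augIdealP 2, IwasawaAlgebra.isPrime_augIdealP_holds 2⟩ ≤
        Literature.NumberTheory.EllipticCurves.Module.lengthAt (IwasawaAlgebra 2)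
            (IwasawaAlgebra 2 ⧸ Ideal.span {Gp})
            ⟨IwasawaAlgebra.augIdealP 2, IwasawaAlgebra.isPrime_augIdealP_holds 2⟩ +
          Literature.NumberTheory.EllipticCurves.Module.lengthAt (IwasawaAlgebra 2) Yr.X
            ⟨IwasawaAlgebra.augIdealP 2, IwasawaAlgebra.isPrime_augIdealP_holds 2⟩

/-- ROAD (b″) NETTED, REGISTERED STUB (PFμ⁺): for every seed-cell curve `W`, Iwasawa's `μ₂ = 0` (growth form) for every
cyclotomic `ℤ₂`-extension of `F = ℚ(W[2], ζ₄)` (the `2`-division field with `i` adjoined; `F ≤ ℚ(W[4])` of `2`-power index).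
One hypothesis for statement (A) and its relaxed-at-∞ form (REF1 §62 (S2)). Iwasawa's `μ`-conjecture at `2` for these
degree-`12` fields — OPEN class-wide (`S₃` image; Ferrero–Washington covers only the abelian case); per seed ONE Fukuda
rank-stabilisation certificate on `Cl(F_n)[2]`. att-p5 g3 (NARROW-A2 v2, stub-OK): the carrier `F = ℚ(μ₄, E[2])` is CORRECT and the
SIMPLEST for Limʳ (no finite-`2`-extension step, no `2`-power-index hypothesis); CERTIFICATE-EQUIVALENT smaller carriers modulo CFT
print ([Iw73] Thm 2/3 «let k be totally imaginary if ℓ = 2», Weber 1899 / Narkiewicz Ch. 3 n. 11): `μ₂(F) = 0 ⟺ μ₂(ℚ(e₁, i)) = 0`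
(sextic) `⟺_{Δ_W<0} μ₂(ℚ(e₁)) = 0` (cubic) — for all 12 certified seeds (`Δ < 0`) the certificate is D-att-p2-1's CUBIC class
numbers; for `Δ_W > 0` members Fukuda on `ℚ(e₁, i)`. Nothing asserted. -/
def PointFieldMuCycAtTwo : Prop :=
  ∀ (W : WeierstrassCurve ℚ) [W.IsElliptic] [W.IsGloballyMinimal], ¬ W.HasCM →
    IsOrdinaryAt W 2 → (∀ x : ℚ, ¬ HasRationalTwoTorsionX W x) → ¬ IsSquare W.Δ →
    W.analyticRank = 0 → BSDp W 2 →
    ∀ i : AlgebraicClosure ℚ, i ^ 2 = -1 →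
    ∀ κL : ZpExtension ↥(W.divisionField 2 ⊔ IntermediateField.adjoin ℚ {i}) 2,
      κL.IsCyclotomic → ClassicalMuVanishes κL

/-- DISPLAYED for typing (road (b″) netted, K₂ⁿᵉᵗʳ — att-p3 g3 p601771, the hypothesis `hK2nr` of
`…FineRoad.muInequalityRelAtTwo_of_katoNetDataRel` VERBATIM): for every `W` good ordinary at `2` with no rational `2`-torsion,
every cyclotomic datum `(κ, γ)`, newform `f`, integral lift `G₊` of `L₂(f, α)`, every `D : SelmerDualData` and
`Yr : FineSelmerDualDataRelaxedInf` — Kato's row `P → X' → Y' → 0` over `ℚ(ζ_{2^∞})` (`X' = X(E/K_∞)`, `Y' = X₀(E/K_∞)`,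
`K = ℚ(i)`) with `Δ`-action (`cP`, `cX`, `cY`), an injective `Δ`-equivariant Coleman map `col : P → Λ₀ × Λ₀` with FINITE
cokernel, zeta images `w₁ ↦ (a, b)`, `w₂ ↦ (b, a)` in `ker toX` with `a + b = 2^e·s·G₊`, `s ∉ (2)`, for SOME `e : ℕ`, a relaxed
descent `fd : X'_Δ → Xr` with finite cokernel, an archimedean extension `q : Xr ↠ D.X` with `e ≤ ℓ₍₂₎(ker q)`, and a fine
comparison `fyr : Y'_Δ → Yr.X` with `ℓ₍₂₎(ker fyr) = 0`. PRINT at `2` pending typing, BOTH signs of `Δ_W` (Kato 17.4 (1),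
Prop. 17.11, §17.13 with (17.13.1) exact over `ℚ(ζ_{2^∞})`, Thm. 16.6; Greenberg LNM 1716 Lemma 4.6; inf–res). As every
`∃`-over-Types shape it certifies no provenance; nothing asserted. -/
def KatoNetDataRelAtTwo : Prop :=
  ∀ (W : WeierstrassCurve ℚ) [W.IsElliptic] [W.IsGloballyMinimal], IsOrdinaryAt W 2 →
    (∀ x : ℚ, ¬ HasRationalTwoTorsionX W x) →
    ∀ (κ : ZpExtension ℚ 2) (γ : Field.absoluteGaloisGroup ℚ), κ.IsCyclotomic →
    κ.IsTopGenerator γ → IsCyclotomicVariable 2 γ →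
    ∀ ⦃N : ℕ⦄ [NeZero N] (f : CuspForm (Gamma0 N) 2), IsNewformOf W f →
    ∀ Gp : IwasawaAlgebra 2, iwasawaToPowerSeries 2 Gp = padicLFunction f (unitRoot W 2 : ℚ_[2]) →
    ∀ (D : W.SelmerDualData κ γ) (Yr : W.FineSelmerDualDataRelaxedInf κ γ),
      ∃ (P X' Y' Xr : Type) (_ : AddCommGroup P) (_ : _root_.Module (IwasawaAlgebra 2) P)
        (_ : AddCommGroup X') (_ : _root_.Module (IwasawaAlgebra 2) X')
        (_ : AddCommGroup Y') (_ : _root_.Module (IwasawaAlgebra 2) Y')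
        (_ : AddCommGroup Xr) (_ : _root_.Module (IwasawaAlgebra 2) Xr)
        (toX : P →ₗ[IwasawaAlgebra 2] X') (π : X' →ₗ[IwasawaAlgebra 2] Y')
        (cP : P →ₗ[IwasawaAlgebra 2] P) (cX : X' →ₗ[IwasawaAlgebra 2] X')
        (cY : Y' →ₗ[IwasawaAlgebra 2] Y')
        (col : P →ₗ[IwasawaAlgebra 2] IwasawaAlgebra 2 × IwasawaAlgebra 2) (w₁ w₂ : P)
        (a b s : IwasawaAlgebra 2) (e : ℕ) (fd : (X' ⧸ LinearMap.range (cX - 1)) →ₗ[IwasawaAlgebra 2] Xr)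
        (q : Xr →ₗ[IwasawaAlgebra 2] D.X)
        (fyr : (Y' ⧸ LinearMap.range (cY - 1)) →ₗ[IwasawaAlgebra 2] Yr.X),
        Function.Exact toX π ∧ Function.Surjective π ∧ toX ∘ₗ cP = cX ∘ₗ toX ∧ π ∘ₗ cX = cY ∘ₗ π ∧
        Function.Injective col ∧
        col ∘ₗ cP = (LinearEquiv.prodComm (IwasawaAlgebra 2) (IwasawaAlgebra 2) (IwasawaAlgebra 2) :
          IwasawaAlgebra 2 × IwasawaAlgebra 2 →ₗ[IwasawaAlgebra 2]
            IwasawaAlgebra 2 × IwasawaAlgebra 2) ∘ₗ col ∧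
        Finite ((IwasawaAlgebra 2 × IwasawaAlgebra 2) ⧸ LinearMap.range col) ∧
        toX w₁ = 0 ∧ toX w₂ = 0 ∧ col w₁ = (a, b) ∧ col w₂ = (b, a) ∧
        s ∉ IwasawaAlgebra.augIdealP 2 ∧ a + b = PowerSeries.C ((2 : ℤ_[2]) ^ e) * s * Gp ∧
        Finite (Xr ⧸ LinearMap.range fd) ∧ Function.Surjective q ∧
        (e : ℕ∞) ≤ Literature.NumberTheory.EllipticCurves.Module.lengthAt (IwasawaAlgebra 2) (LinearMap.ker q)
            ⟨IwasawaAlgebra.augIdealP 2, IwasawaAlgebra.isPrime_augIdealP_holds 2⟩ ∧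
        Literature.NumberTheory.EllipticCurves.Module.lengthAt (IwasawaAlgebra 2) (LinearMap.ker fyr)
            ⟨IwasawaAlgebra.augIdealP 2, IwasawaAlgebra.isPrime_augIdealP_holds 2⟩ = 0

/-- stub P — PRINT (named facts; closes only conditionally). -/
theorem stub_publishedInputsAtTwo : PublishedInputsAtTwo := by
  sorry

/-- stub T — ROAD (a), OPEN: Greenberg's `μ`-conjecture at `2` on the seed cell (⟸
`Rank1Residual.GreenbergMuConjectureIrreducible`; modulo stub P the crux is EQUIVALENT to it). -/
theorem stub_seedMuZeroAtTwo : SeedMuZeroAtTwo := by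
  sorry

/-- stub Kμ — ROAD (c), TARGET: Kato's `𝔭 = (2)` clause on the seed cell (`X5.O1.KatoMuPartAtTwo`; ⟺ T modulo P). -/
theorem stub_seedKatoMuPartAtTwo : SeedKatoMuPartAtTwo := by
  sorry

/-- stub LimDoor — PRINT (named fact `Lim2017.thm35_at_two_upstairs_fineSelmer_twoTorsion_finite_of_classicalMuVanishes`,
statement-only, p605725; closes only conditionally, like stub P). -/
theorem stub_limUpstairsDoorAtTwo : LimUpstairsDoorAtTwo := by
  sorry

/-- glue Limʳ ⟸ LimDoor — PROVED by att-p5 g4's kernel `AlignedTransportAtTwoFineRoad.LimRelUpstairs.limRelAtTwo_of_lim2017`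
(p605868/p606004 over p605654 `…FineRoadLimDescent`: 2-torsion inflation–restriction + the relaxed dual side). From v8 on Limʳ is no
longer a registered stub: it is PRINT by name. -/
theorem limRel_glue : LimUpstairsDoorAtTwo → LimRelAtTwo :=
  fun h =>
    Summit.BirchSwinnertonDyer.BirchSwinnertonDyer.Theorems.AlignedTransportAtTwoFineRoad.LimRelUpstairs.limRelAtTwo_of_lim2017 h

/-- stub MuIneqʳ — ROAD (b″) netted: Kato's `μ`-inequality at `2` against the relaxed-at-∞ fine dual (PRINT pending typing,
both signs of `Δ_W`). -/
theorem stub_muInequalityRelAtTwo : MuInequalityRelAtTwo := by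
  sorry

/-- stub PFμ⁺ — ROAD (b″) netted: Iwasawa's `μ₂ = 0` for the cyclotomic `ℤ₂`-tower of ℚ(W[2], ζ₄), every seed (OPEN class-wide). -/
theorem stub_pointFieldMuCycAtTwo : PointFieldMuCycAtTwo := by
  sorry

/-- stub E — the converse chain at `2`: CLOSED (no sorry) by the landed kernel
`AlignedTransportAtTwoSeed.mainConjectureOfRankZeroBSDAtTwo_of_seedMuZero` (p583329, ACCEPTED). -/
theorem stub_equalityFromEnds : PublishedInputsAtTwo → SeedMuZeroAtTwo → MainConjectureOfRankZeroBSDAtTwo :=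
  fun hP hT =>
    Summit.BirchSwinnertonDyer.BirchSwinnertonDyer.Theorems.AlignedTransportAtTwoSeed.mainConjectureOfRankZeroBSDAtTwo_of_seedMuZero
      hP.1 hP.2.1 hP.2.2.1 hP.2.2.2.1 hP.2.2.2.2 hT

/-- glue of ROAD (b) (displayed Props `LimAtTwo`, `KatoFineDataAtTwo`, `ClassicalMuSeedFieldsAtTwo`, not
registered as stubs) — PROVED by the landed kernel `AlignedTransportAtTwoFineRoad.seedMuZeroAtTwo_of_fineRoad`:
P (modularity) + Lim + K₂ + A₂ ⟹ T. -/
theorem roadB_glue :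
    PublishedInputsAtTwo → LimAtTwo → KatoFineDataAtTwo → ClassicalMuSeedFieldsAtTwo → SeedMuZeroAtTwo :=
  fun hP hL hK hA =>
    Summit.BirchSwinnertonDyer.BirchSwinnertonDyer.Theorems.AlignedTransportAtTwoFineRoad.seedMuZeroAtTwo_of_fineRoad
      hP.2.2.2.1 hL hK hA

/-- glue of ROAD (b′) (displayed Props, not registered) — PROVED by the landed kernel
`AlignedTransportAtTwoFineRoad.seedMuZeroAtTwo_of_fineRoadQi`: P (modularity) + K₂′ + Mu⁻ + A₂′ ⟹ T. -/
theorem roadBQi_glue :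
    PublishedInputsAtTwo → KatoFineDataQiAtTwo → OddBranchMuZeroAtTwo → ConjAQiSeedsAtTwo →
      SeedMuZeroAtTwo :=
  fun hP hK hM hA =>
    Summit.BirchSwinnertonDyer.BirchSwinnertonDyer.Theorems.AlignedTransportAtTwoFineRoad.seedMuZeroAtTwo_of_fineRoadQi
      hP.2.2.2.1 hK hM hA

/-- glue of ROAD (b″) — PROVED by the landed kernel
`AlignedTransportAtTwoFineRoad.seedMuZeroAtTwo_of_fineRoadCoinvArch`: P (modularity) + Lim + K₂″ + A₂ ⟹ T. -/
theorem stub_fineRoadCoinv :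
    PublishedInputsAtTwo → LimAtTwo → KatoCoinvDataQiAtTwo → ClassicalMuSeedFieldsAtTwo → SeedMuZeroAtTwo :=
  fun hP hL hK hA =>
    Summit.BirchSwinnertonDyer.BirchSwinnertonDyer.Theorems.AlignedTransportAtTwoFineRoad.seedMuZeroAtTwo_of_fineRoadCoinvArch
      hP.2.2.2.1 hL hK hA

/-- glue of ROAD (c) — PROVED by the landed kernel `AlignedTransportAtTwoKatoMuRoad.seedMuZero_iff_seedKatoMuPartAtTwo`
(p597991): P (Kato 17.4 (1) at `2`, period unit, modularity) + Kμ ⟹ T (the cell's analytic binder is used). -/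
theorem roadC_glue : PublishedInputsAtTwo → SeedKatoMuPartAtTwo → SeedMuZeroAtTwo :=
  fun hP hK =>
    (Summit.BirchSwinnertonDyer.BirchSwinnertonDyer.Theorems.AlignedTransportAtTwoKatoMuRoad.seedMuZero_iff_seedKatoMuPartAtTwo
      hP.1 hP.2.2.1 hP.2.2.2.1).mpr hK

/-- converse glue of ROAD (c) — PROVED (same kernel): P + T ⟹ Kμ; so Kμ ⟺ T modulo P. -/
theorem roadC_glue_converse : PublishedInputsAtTwo → SeedMuZeroAtTwo → SeedKatoMuPartAtTwo :=
  fun hP hT =>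
    (Summit.BirchSwinnertonDyer.BirchSwinnertonDyer.Theorems.AlignedTransportAtTwoKatoMuRoad.seedMuZero_iff_seedKatoMuPartAtTwo
      hP.1 hP.2.2.1 hP.2.2.2.1).mp hT

/-- glue A₂ ⟸ PFμ — PROVED by att-p5 g2's kernel `AlignedTransportAtTwoTorsionPointField.classicalMuSeedFields_of_pointFieldMu`
(`ℚ(P) ≤ ℚ(W[4])` of `2`-power index, structurally). -/
theorem classicalMuSeedFields_of_pointFieldMu : PointFieldMuAtTwo → ClassicalMuSeedFieldsAtTwo :=
  fun h =>
    Summit.BirchSwinnertonDyer.BirchSwinnertonDyer.Theorems.AlignedTransportAtTwoTorsionPointField.classicalMuSeedFields_of_pointFieldMu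
      h

/-- glue K₂″ ⟹ MuIneq — PROVED by att-p3 g2's kernel `AlignedTransportAtTwoFineRoad.muInequalityAtTwo_of_katoCoinvDataQiAtTwo`
(the displayed `∃`-data give the bare inequality; conversely a junk model realises the data, `…FineRoadCoinvDataJunk`). -/
theorem muInequality_of_katoCoinvData : KatoCoinvDataQiAtTwo → MuInequalityAtTwo :=
  fun h =>
    Summit.BirchSwinnertonDyer.BirchSwinnertonDyer.Theorems.AlignedTransportAtTwoFineRoad.muInequalityAtTwo_of_katoCoinvDataQiAtTwo
      h

/-- glue K₂ⁿᵉᵗʳ ⟹ MuIneqʳ — PROVED by att-p3 g3's kernel `AlignedTransportAtTwoFineRoad.muInequalityRelAtTwo_of_katoNetDataRel`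
(p601771; the netting lemma `lengthAt_le_of_coinvDatum_netting`, p600554: the period `2^e` cancels against `e ≤ ℓ₍₂₎(ker q)`). -/
theorem muInequalityRel_of_katoNetDataRel : KatoNetDataRelAtTwo → MuInequalityRelAtTwo :=
  fun h =>
    Summit.BirchSwinnertonDyer.BirchSwinnertonDyer.Theorems.AlignedTransportAtTwoFineRoad.muInequalityRelAtTwo_of_katoNetDataRel
      h

/-- glue of the REGISTERED road (b″) — PROVED by att-p3 g2's kernel
`AlignedTransportAtTwoFineRoad.seedMuZeroAtTwo_of_muInequalityAtTwo` + att-p5 g2's point-field glue: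
P (modularity) + Lim + MuIneq + PFμ ⟹ T. -/
theorem roadB2ineq_glue :
    PublishedInputsAtTwo → LimAtTwo → MuInequalityAtTwo → PointFieldMuAtTwo → SeedMuZeroAtTwo :=
  fun hP hL hI hμ =>
    Summit.BirchSwinnertonDyer.BirchSwinnertonDyer.Theorems.AlignedTransportAtTwoFineRoad.seedMuZeroAtTwo_of_muInequalityAtTwo
      hP.2.2.2.1 hL hI (classicalMuSeedFields_of_pointFieldMu hμ)

/-- glue of the NETTED road (b″) — PROVED here from att-p3 g2's kernel `AlignedTransportAtTwoFineRoad.lengthAt_eq_zero_of_muInequality`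
(any target pair) + the existence of the relaxed-at-∞ fine dual (-ty p600292 `fineSelmerDualDataRelaxedInf`):
P (modularity) + Limʳ + MuIneqʳ + PFμ⁺ ⟹ T. The even-branch binder `red G₊ ≠ 0` of the crux is load-bearing. -/
theorem roadB2rel_glue :
    PublishedInputsAtTwo → LimRelAtTwo → MuInequalityRelAtTwo → PointFieldMuCycAtTwo → SeedMuZeroAtTwo := by
  intro hP hL hI hμ W _ _ hcm hord ht hsq hr hμan hbsd κ γ hκ hγ hγ' D _
  let 𝔭 : PrimeSpectrum (IwasawaAlgebra 2) :=
    ⟨IwasawaAlgebra.augIdealP 2, IwasawaAlgebra.isPrime_augIdealP_holds 2⟩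
  have hirr :=
    Summit.BirchSwinnertonDyer.BirchSwinnertonDyer.Theorems.AlignedTransportAtTwoSeed.irr_two_of_forall_not_hasRationalTwoTorsionX
      W ht
  haveI : NeZero (W.conductorNorm ℤ) := ⟨(W.conductorNorm_pos_holds).ne'⟩
  obtain ⟨Dm⟩ := hP.2.2.2.1 W
  obtain ⟨Gp, hGp⟩ := exists_iwasawaToPowerSeries_eq_padicLFunction_two hord Dm.isNewformOf hirr
  have hred : red Gp ≠ 0 := hμan Dm.f Dm.isNewformOf Gp (Or.inl ⟨hord, hGp⟩)
  let Yr : W.FineSelmerDualDataRelaxedInf κ γ := W.fineSelmerDualDataRelaxedInf κ hγ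
  obtain ⟨i, hi⟩ : ∃ i : AlgebraicClosure ℚ, i ^ 2 = -1 := IsAlgClosed.exists_pow_nat_eq (-1) (by norm_num)
  have hY : Literature.NumberTheory.EllipticCurves.Module.lengthAt (IwasawaAlgebra 2) Yr.X 𝔭 = 0 :=
    hL W hord ht i hi (hμ W hcm hord ht hsq hr hbsd i hi) κ γ hκ hγ hγ' Yr
  have hX0 : Literature.NumberTheory.EllipticCurves.Module.lengthAt (IwasawaAlgebra 2) D.X 𝔭 = 0 :=
    Summit.BirchSwinnertonDyer.BirchSwinnertonDyer.Theorems.AlignedTransportAtTwoFineRoad.lengthAt_eq_zero_of_muInequality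
      2 𝔭 rfl hred hY (hI W hord ht κ γ hκ hγ hγ' Dm.f Dm.isNewformOf Gp hGp D Yr)
  change muInvariant 2 D.X = 0
  rw [muInvariant_eq_toNat_lengthAt 2 D.X 𝔭 rfl, hX0]
  rfl

/-- Composition, ROAD (a) (kernel-checked): the crux BY NAME from stubs P, T, E. -/
theorem MainConjectureOfRankZeroBSDAtTwo_of (hP : PublishedInputsAtTwo) (hT : SeedMuZeroAtTwo)
    (hE : PublishedInputsAtTwo → SeedMuZeroAtTwo → MainConjectureOfRankZeroBSDAtTwo) :
    MainConjectureOfRankZeroBSDAtTwo := hE hP hT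

/-- Composition, ROAD (b) (kernel-checked): the crux BY NAME from P and the displayed Lim, K₂, A₂. -/
theorem MainConjectureOfRankZeroBSDAtTwo_of_roadB (hP : PublishedInputsAtTwo) (hL : LimAtTwo)
    (hK : KatoFineDataAtTwo) (hA : ClassicalMuSeedFieldsAtTwo) : MainConjectureOfRankZeroBSDAtTwo :=
  stub_equalityFromEnds hP (roadB_glue hP hL hK hA)

/-- Composition, ROAD (b′) (kernel-checked): the crux BY NAME from P and the displayed K₂′, Mu⁻, A₂′. -/
theorem MainConjectureOfRankZeroBSDAtTwo_of_roadBQi (hP : PublishedInputsAtTwo) (hK : KatoFineDataQiAtTwo)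
    (hM : OddBranchMuZeroAtTwo) (hA : ConjAQiSeedsAtTwo) : MainConjectureOfRankZeroBSDAtTwo :=
  stub_equalityFromEnds hP (roadBQi_glue hP hK hM hA)

/-- Composition, ROAD (b″) (kernel-checked): the crux BY NAME from stubs P, Lim, K₂″, A₂ (and the glues). -/
theorem MainConjectureOfRankZeroBSDAtTwo_of_roadB2 (hP : PublishedInputsAtTwo) (hL : LimAtTwo)
    (hK : KatoCoinvDataQiAtTwo) (hA : ClassicalMuSeedFieldsAtTwo) : MainConjectureOfRankZeroBSDAtTwo :=
  stub_equalityFromEnds hP (stub_fineRoadCoinv hP hL hK hA)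

/-- The crux from the registered stubs, road (a) (no hypotheses). -/
theorem MainConjectureOfRankZeroBSDAtTwo_holds_of_stubs : MainConjectureOfRankZeroBSDAtTwo :=
  MainConjectureOfRankZeroBSDAtTwo_of stub_publishedInputsAtTwo stub_seedMuZeroAtTwo stub_equalityFromEnds

/-- Composition, ROAD (c) (kernel-checked): the crux BY NAME from stubs P, Kμ (through T and E). -/
theorem MainConjectureOfRankZeroBSDAtTwo_of_roadC (hP : PublishedInputsAtTwo) (hK : SeedKatoMuPartAtTwo) :
    MainConjectureOfRankZeroBSDAtTwo :=
  stub_equalityFromEnds hP (roadC_glue hP hK)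

/-- Composition, REGISTERED ROAD (b″) (kernel-checked): the crux BY NAME from stubs P, Lim, MuIneq, PFμ. -/
theorem MainConjectureOfRankZeroBSDAtTwo_of_roadB2ineq (hP : PublishedInputsAtTwo) (hL : LimAtTwo)
    (hI : MuInequalityAtTwo) (hμ : PointFieldMuAtTwo) : MainConjectureOfRankZeroBSDAtTwo :=
  stub_equalityFromEnds hP (roadB2ineq_glue hP hL hI hμ)

/-- The crux from the registered stubs, road (c) (no hypotheses). -/
theorem MainConjectureOfRankZeroBSDAtTwo_holds_of_stubs_roadC : MainConjectureOfRankZeroBSDAtTwo :=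
  MainConjectureOfRankZeroBSDAtTwo_of_roadC stub_publishedInputsAtTwo stub_seedKatoMuPartAtTwo

/-- Composition, NETTED ROAD (b″) (kernel-checked): the crux BY NAME from stubs P, Limʳ, MuIneqʳ, PFμ⁺. -/
theorem MainConjectureOfRankZeroBSDAtTwo_of_roadB2rel (hP : PublishedInputsAtTwo) (hL : LimRelAtTwo)
    (hI : MuInequalityRelAtTwo) (hμ : PointFieldMuCycAtTwo) : MainConjectureOfRankZeroBSDAtTwo :=
  stub_equalityFromEnds hP (roadB2rel_glue hP hL hI hμ)

/-- Composition, NETTED ROAD (b″) with the displayed data (kernel-checked): the crux BY NAME from P, Limʳ, K₂ⁿᵉᵗʳ, PFμ⁺. -/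
theorem MainConjectureOfRankZeroBSDAtTwo_of_roadB2net (hP : PublishedInputsAtTwo) (hL : LimRelAtTwo)
    (hK : KatoNetDataRelAtTwo) (hμ : PointFieldMuCycAtTwo) : MainConjectureOfRankZeroBSDAtTwo :=
  MainConjectureOfRankZeroBSDAtTwo_of_roadB2rel hP hL (muInequalityRel_of_katoNetDataRel hK) hμ

/-- PRINT (necessity side, v8): the tree's statement-only named fact
`Literature.NumberTheory.EllipticCurves.prop416_classicalMuVanishes_divisionField_two_of_fineSelmer_twoTorsion_finite` (Greenberg 2011
Prop. 4.1.6 (iii) ⇒ (i) + Remark 4.1.7 at `p = 2`, `K = ℚ(E[2])`: statement (A) for an `S₃`-curve over `ℚ^{cyc}` ⟹ the vanishing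
of `μ₂` for the cyclotomic `ℤ₂`-extension of `ℚ(E[2])`; p607299, in-print assembly per REF2-PLACEMENT-v17 §3). Nothing asserted. -/
def GreenbergDescentDoorAtTwo : Prop :=
  Literature.NumberTheory.EllipticCurves.prop416_classicalMuVanishes_divisionField_two_of_fineSelmer_twoTorsion_finite

/-- **NECESSITY (kernel-checked, p607593): the crux CONTAINS Iwasawa's `μ₂`-statement for the sextics `ℚ(W[2])`.** From stub P
(only the period unit and modularity are used), the Greenberg-2011 door and `MainConjectureOfRankZeroBSDAtTwo`: for every seed-cell
curve `W` with `BSD(W, 2)`, every cyclotomic `ℤ₂`-extension of `ℚ(W[2])` has `μ = 0` in growth form. No Kato input in this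
direction (`…MuNecessity.classicalMuVanishes_divisionField_two_of_mainConjectureOfRankZeroBSDAtTwo`: MC₂(W) ⟹ `μ(X) = 0`
⟹ (A)₂(W) ⟹ door). So any proof of the ∀-`W` crux proves the vanishing of `μ₂` for infinitely many `S₃`-sextic fields. -/
theorem necessity_classicalMu_divisionField_two (hP : PublishedInputsAtTwo) (hG : GreenbergDescentDoorAtTwo)
    (hC2 : MainConjectureOfRankZeroBSDAtTwo) :
    ∀ (W : WeierstrassCurve ℚ) [W.IsElliptic] [W.IsGloballyMinimal], ¬ W.HasCM →
      IsOrdinaryAt W 2 → (∀ x : ℚ, ¬ HasRationalTwoTorsionX W x) → ¬ IsSquare W.Δ →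
      W.analyticRank = 0 →
      (∀ ⦃N : ℕ⦄ [NeZero N] (f : CuspForm (Gamma0 N) 2), IsNewformOf W f →
        ∀ G : IwasawaAlgebra 2, IsEvenBranchLiftAtTwo W f G → red G ≠ 0) →
      BSDp W 2 →
      ∀ κF : ZpExtension (W.divisionField 2) 2, κF.IsCyclotomic → ClassicalMuVanishes κF :=
  fun W _ _ hcm hord ht hsq hr hμan hbsd =>
    Summit.BirchSwinnertonDyer.BirchSwinnertonDyer.Theorems.AlignedTransportAtTwoMuNecessity.classicalMuVanishes_divisionField_two_of_mainConjectureOfRankZeroBSDAtTwo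
      W hP.2.2.1 hP.2.2.2.1 hG hC2 hcm hord ht hsq hr hμan hbsd

/-- **THE SEXTIC CRITERION on `Δ_W < 0` (kernel-checked, p608587).** From stubs P, the Lim door `LimAtTwo`, the Greenberg door and
the registered MuIneqʳ: the crux restricted to `Δ_W < 0` ⟺ Iwasawa's `μ₂ = 0` for `ℚ(W[2])^{cyc}` for every such cell curve `W`
with `BSD(W, 2)`. So on three quarters of the cell the registered OPEN content (T, equivalently Kμ, or PFμ⁺) can be replaced by the
classical statement about the sextics, both ways. -/
theorem sexticCriterion_negDisc (hP : PublishedInputsAtTwo) (hL : LimAtTwo) (hG : GreenbergDescentDoorAtTwo)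
    (hI : MuInequalityRelAtTwo) :
    (∀ (W : WeierstrassCurve ℚ) [W.IsElliptic] [W.IsGloballyMinimal], ¬ W.HasCM →
        IsOrdinaryAt W 2 → (∀ x : ℚ, ¬ HasRationalTwoTorsionX W x) → ¬ IsSquare W.Δ → W.Δ < 0 →
        W.analyticRank = 0 →
        (∀ ⦃N : ℕ⦄ [NeZero N] (f : CuspForm (Gamma0 N) 2), IsNewformOf W f →
          ∀ G : IwasawaAlgebra 2, IsEvenBranchLiftAtTwo W f G → red G ≠ 0) →
        BSDp W 2 → MazurMainConjecture W 2) ↔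
    (∀ (W : WeierstrassCurve ℚ) [W.IsElliptic] [W.IsGloballyMinimal], ¬ W.HasCM →
        IsOrdinaryAt W 2 → (∀ x : ℚ, ¬ HasRationalTwoTorsionX W x) → ¬ IsSquare W.Δ → W.Δ < 0 →
        W.analyticRank = 0 →
        (∀ ⦃N : ℕ⦄ [NeZero N] (f : CuspForm (Gamma0 N) 2), IsNewformOf W f →
          ∀ G : IwasawaAlgebra 2, IsEvenBranchLiftAtTwo W f G → red G ≠ 0) →
        BSDp W 2 → ∀ κF : ZpExtension (W.divisionField 2) 2, κF.IsCyclotomic → ClassicalMuVanishes κF) :=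
  Summit.BirchSwinnertonDyer.BirchSwinnertonDyer.Theorems.AlignedTransportAtTwoSexticCriterion.crux_negDisc_iff_classicalMu_divisionField_two
    hP.1 hP.2.1 hP.2.2.1 hP.2.2.2.1 hP.2.2.2.2 hL hG hI

/-- The crux from the registered stubs, netted road (b″) (no hypotheses). -/
theorem MainConjectureOfRankZeroBSDAtTwo_holds_of_stubs_roadB2 : MainConjectureOfRankZeroBSDAtTwo :=
  MainConjectureOfRankZeroBSDAtTwo_of_roadB2rel stub_publishedInputsAtTwo (limRel_glue stub_limUpstairsDoorAtTwo)
    stub_muInequalityRelAtTwo stub_pointFieldMuCycAtTwo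

/-- Composition, NETTED ROAD (b″) of v8 (kernel-checked): the crux BY NAME from stubs P, LimDoor, MuIneqʳ, PFμ⁺. -/
theorem MainConjectureOfRankZeroBSDAtTwo_of_roadB2door (hP : PublishedInputsAtTwo) (hD : LimUpstairsDoorAtTwo)
    (hI : MuInequalityRelAtTwo) (hμ : PointFieldMuCycAtTwo) : MainConjectureOfRankZeroBSDAtTwo :=
  MainConjectureOfRankZeroBSDAtTwo_of_roadB2rel hP (limRel_glue hD) hI hμ

end Summit.BirchSwinnertonDyer.BirchSwinnertonDyer.Cruxes.MainConjectureOfRankZeroBSDAtTwo.Birth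

end
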